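import Mathlib
import Summits.CriticalPhenomena.PercolationContinuityZ3.Theorems.PercNearOneGluingNoHeavyLowerTailIntervalCertificates

/-!
# Ordered Marica–Schönheim with reserved terms; the trace lemma; (MS2) from an order certificate (hp-7 gen 76)

Support file for crux `stmt-CriticalPhenomena-4575` (route `PercNearOneGluingNoHeavy`), hull-port seat `prim-hp-7`
(generation 76); `--supports stmt-CriticalPhenomena-4575`.  No `sorry`.  Memo:
`run/shared/lean/prim/prim-hp-7/FROM-prim-hp-7-g76-ORDER-CERTIFICATES.md`.

The second-order Marica–Schönheim conjecture (`GeneratedDonors.MS2`, file `…HexMSMatchMS2`): for a two-coloured family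
`F = P ⊔ Q` with designated pure cross differences `D₅ ⊆ P \\ Q`, `D₂ ⊆ Q \\ P`,
`#(F ∪ D₅ ∪ D₂) ≤ #(F \\ F ∪ P \\ D₅ ∪ Q \\ D₂)`.  Gens 72–74 proved the MS-tight case, the one-type case without
cross containment and the hypothesis-free one-block inequality (W′) (`…HexMSMatchTopsSuffice`).  This file lands the
reduction found in gen 76 and its first unconditional consequence.

* `ReservedTerms.card_add_card_le_card_of_reserved` — **ordered Marica–Schönheim with reserved terms.**  If a rank function
  on a family `F` makes every 'forward' difference `f \ g` (`f ≠ g`, `r f ≤ r g`) a nonempty member of a term set `T ∋ ∅`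
  outside a reserved subfamily `Θ ⊆ T \ {∅}`, then `#F + #Θ ≤ #T`.  (Interval certificate with rows `[∅, f]`, columns
  `S \ f`, on `K = T \ Θ`.)
* `ReservedTerms.ms2_of_orderCert` — **(MS2) from an order certificate**: an order on `F = P ∪ Q` plus an injection `τ` of the
  designated differences into the nonempty terms that never hits a forward difference gives the (MS2) inequality for that
  instance.  NUMERICAL FACT (gen 76, memo §1): such certificates with `τ d ∈ {d} ∪ {m \ d : m in d's block}` exist for every
  intersecting instance tested (`n ≤ 7`, exhaustive on `2^[4]`, kit `j282754`), so (MS2) for dead families is reduced to a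
  pure ordering problem (conjecture `C0`, memo §2).
* `ReservedTerms.card_add_card_le_card_diffs_of_injOn_sdiff` — **the trace lemma** (unconditional): if the traces `f \ U` of the
  members outside a set `U` are pairwise distinct, then ALL nonzero differences inside `U` are free simultaneously:
  `#F + #{t ∈ F \\ F | t ≠ ∅, t ⊆ U} ≤ #(F \\ F)` (rank `-#(f \ U)`).
* `ReservedTerms.ms2_of_injOn_sdiff`, `ReservedTerms.ms2_of_injOn_sdiff'` — **(MS2) whenever the members are pairwise
  distinct outside `⋃ (D₅ ∪ D₂)`** (any `F`, no purity or intersection hypothesis beyond `∅ ∉ D₅ ∪ D₂`).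
-/

namespace Summit.CriticalPhenomena.PercolationContinuityZ3.Theorems

namespace ReservedTerms

open Finset
open scoped FinsetFamily

variable {α : Type*} [DecidableEq α]

/-- **Ordered Marica–Schönheim with reserved terms** (hp-7 gen 76).  Let `T ∋ ∅` be a family of 'terms', `Θ ⊆ T` a reserved
subfamily not containing `∅`, and `r` a rank function on a family `F` such that for `f ≠ g` in `F` with `r f ≤ r g` the forward
difference `f \ g` is a nonempty member of `T` outside `Θ`.  Then `#F + #Θ ≤ #T`.  (`Θ = ∅`, `T = F \\ F`, `r = -#·` is
Marica–Schönheim.) -/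
theorem card_add_card_le_card_of_reserved {β : Type*} [LinearOrder β] (F T Θ : Finset (Finset α))
    (r : Finset α → β) (h0 : (∅ : Finset α) ∈ T) (hΘT : Θ ⊆ T) (h0Θ : (∅ : Finset α) ∉ Θ)
    (hfwd : ∀ f ∈ F, ∀ g ∈ F, f ≠ g → r f ≤ r g → f \ g ∈ T ∧ f \ g ≠ ∅ ∧ f \ g ∉ Θ) :
    #F + #Θ ≤ #T := by
  classical
  set K : Finset (Finset α) := T \ Θ with hK
  have hKcard : #K + #Θ = #T := card_sdiff_add_card_eq_card hΘT
  suffices hF : #F ≤ #K by omega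
  let S : Finset α := F.sup id
  have hS : ∀ {f : Finset α}, f ∈ F → f ⊆ S := fun hf => le_sup (f := id) hf
  have hUV : ∀ {f g : Finset α}, f ⊆ S → f ∩ (S \ g) = f \ g := by
    intro f g hfS
    ext x
    simp only [mem_inter, mem_sdiff]
    constructor
    · rintro ⟨hxf, -, hxg⟩
      exact ⟨hxf, hxg⟩
    · rintro ⟨hxf, hxg⟩
      exact ⟨hxf, hfS hxf, hxg⟩
  have hmain := IntervalCertificate.card_le_card_of_certificate (ι := ↥F) K (fun f => r (f : Finset α))
    (fun _ => (∅ : Finset α)) (fun f => (f : Finset α)) (fun f => S \ (f : Finset α)) ?_ ?_ ?_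
  · rwa [Fintype.card_coe] at hmain
  · rintro ⟨f, hf⟩
    simp only [hUV (hS hf), sdiff_self]
    rfl
  · intro _
    exact mem_sdiff.mpr ⟨h0, h0Θ⟩
  · rintro ⟨f, hf⟩ ⟨g, hg⟩ hne hr
    right
    have hne' : f ≠ g := fun h => hne (Subtype.ext h)
    obtain ⟨hT, hne0, hΘ⟩ := hfwd f hf g hg hne' hr
    simp only [hUV (hS hf)]
    exact ⟨mem_sdiff.mpr ⟨hT, hΘ⟩, hne0⟩

/-- **(MS2) from an order certificate** (hp-7 gen 76).  Let `D₅ ⊆ P \\ Q`, `D₂ ⊆ Q \\ P`, `T = F \\ F ∪ P \\ D₅ ∪ Q \\ D₂`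
(`F = P ∪ Q`).  Suppose a rank function `r` on `F` and a map `τ`, injective on `D₅ ∪ D₂` with nonempty values in `T`, are such
that for `f ≠ g` in `F` with `r f ≤ r g` the forward difference `f \ g` is nonempty and is not a value `τ d`.  Then
`#(F ∪ D₅ ∪ D₂) ≤ #T`.  (Numerically such certificates — with `τ d = d` or `τ d = m \ d`, `m` in the block of `d` — exist for
every intersecting instance tested; memo §1.) -/
theorem ms2_of_orderCert {β : Type*} [LinearOrder β] (P Q D₅ D₂ : Finset (Finset α))
    (hD₅ : D₅ ⊆ P \\ Q) (hD₂ : D₂ ⊆ Q \\ P) (r : Finset α → β) (τ : Finset α → Finset α)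
    (hτT : ∀ d ∈ D₅ ∪ D₂, τ d ∈ ((P ∪ Q) \\ (P ∪ Q)) ∪ (P \\ D₅) ∪ (Q \\ D₂))
    (hτ0 : ∀ d ∈ D₅ ∪ D₂, τ d ≠ ∅) (hτinj : Set.InjOn τ ↑(D₅ ∪ D₂))
    (hfwd : ∀ f ∈ P ∪ Q, ∀ g ∈ P ∪ Q, f ≠ g → r f ≤ r g →
      f \ g ≠ ∅ ∧ ∀ d ∈ D₅ ∪ D₂, τ d ≠ f \ g) :
    #((P ∪ Q) ∪ D₅ ∪ D₂) ≤ #(((P ∪ Q) \\ (P ∪ Q)) ∪ (P \\ D₅) ∪ (Q \\ D₂)) := by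
  classical
  set F := P ∪ Q with hFdef
  set D := D₅ ∪ D₂ with hDdef
  set T := (F \\ F) ∪ (P \\ D₅) ∪ (Q \\ D₂) with hTdef
  have h1 : (P ∪ Q) ∪ D₅ ∪ D₂ = F ∪ D := by rw [hDdef, union_assoc]
  rw [h1]
  rcases F.eq_empty_or_nonempty with hF0 | hFne
  · -- no members: then `P = Q = ∅` and there are no cross differences
    have hP : P = ∅ := by
      have : P ⊆ F := subset_union_left
      rw [hF0] at this
      exact subset_empty.mp this
    have hD0 : D = ∅ := by
      rw [eq_empty_iff_forall_notMem]
      intro d hd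
      rcases mem_union.mp hd with hd | hd
      · obtain ⟨p, hp, -, -, -⟩ := mem_diffs.mp (hD₅ hd)
        rw [hP] at hp
        simp at hp
      · obtain ⟨-, -, p, hp, -⟩ := mem_diffs.mp (hD₂ hd)
        rw [hP] at hp
        simp at hp
    rw [hF0, hD0]
    simp
  obtain ⟨f₀, hf₀⟩ := hFne
  set Θ := D.image τ with hΘdef
  have hΘcard : #Θ = #D := card_image_of_injOn hτinj
  have h0T : (∅ : Finset α) ∈ T := by
    have : (∅ : Finset α) ∈ F \\ F := mem_diffs.mpr ⟨f₀, hf₀, f₀, hf₀, (by simp : f₀ \ f₀ = ∅)⟩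
    exact mem_union_left _ (mem_union_left _ this)
  have hΘT : Θ ⊆ T := by
    intro t ht
    obtain ⟨d, hd, rfl⟩ := mem_image.mp ht
    exact hτT d hd
  have h0Θ : (∅ : Finset α) ∉ Θ := by
    intro h
    obtain ⟨d, hd, hd0⟩ := mem_image.mp h
    exact hτ0 d hd hd0
  have hres := card_add_card_le_card_of_reserved F T Θ r h0T hΘT h0Θ ?_
  · calc #(F ∪ D) ≤ #F + #D := card_union_le F D
      _ = #F + #Θ := by rw [hΘcard]
      _ ≤ #T := hres
  · intro f hf g hg hne hr
    obtain ⟨hne0, hτ⟩ := hfwd f hf g hg hne hr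
    refine ⟨?_, hne0, ?_⟩
    · exact mem_union_left _ (mem_union_left _ (mem_diffs.mpr ⟨f, hf, g, hg, rfl⟩))
    · intro h
      obtain ⟨d, hd, hdt⟩ := mem_image.mp h
      exact hτ d hd hdt

/-- **The trace lemma** (hp-7 gen 76, unconditional).  If the traces `f \ U` of the members of `F` outside a set `U` are pairwise
distinct, then all nonzero differences of `F` lying inside `U` can be reserved at once:
`#F + #{t ∈ F \\ F | t ≠ ∅ ∧ t ⊆ U} ≤ #(F \\ F)`.  (Ordered Marica–Schönheim with rank `-#(f \ U)`: a forward difference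
contains an element outside `U`.) -/
theorem card_add_card_le_card_diffs_of_injOn_sdiff (F : Finset (Finset α)) (U : Finset α)
    (hinj : Set.InjOn (fun f => f \ U) ↑F) :
    #F + #((F \\ F).filter (fun t => t ≠ ∅ ∧ t ⊆ U)) ≤ #(F \\ F) := by
  classical
  rcases F.eq_empty_or_nonempty with hF0 | ⟨f₀, hf₀⟩
  · subst hF0
    simp
  refine card_add_card_le_card_of_reserved F (F \\ F) _ (fun f => -((f \ U).card : ℤ))
    (mem_diffs.mpr ⟨f₀, hf₀, f₀, hf₀, (by simp : f₀ \ f₀ = ∅)⟩) (filter_subset _ _) (by simp) ?_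
  intro f hf g hg hne hr
  have hcard : #(g \ U) ≤ #(f \ U) := by
    have : -((f \ U).card : ℤ) ≤ -((g \ U).card : ℤ) := hr
    exact_mod_cast (neg_le_neg_iff.mp this)
  -- an element of `f` outside `U` and outside `g`
  have hx : ∃ x ∈ f, x ∉ U ∧ x ∉ g := by
    by_contra hcon
    push Not at hcon
    have hsub : f \ U ⊆ g \ U := by
      intro x hx
      obtain ⟨hxf, hxU⟩ := mem_sdiff.mp hx
      exact mem_sdiff.mpr ⟨hcon x hxf hxU, hxU⟩
    have heq : f \ U = g \ U := eq_of_subset_of_card_le hsub hcard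
    exact hne (hinj hf hg heq)
  obtain ⟨x, hxf, hxU, hxg⟩ := hx
  have hxfg : x ∈ f \ g := mem_sdiff.mpr ⟨hxf, hxg⟩
  refine ⟨mem_diffs.mpr ⟨f, hf, g, hg, rfl⟩, ne_empty_of_mem hxfg, ?_⟩
  intro hmem
  obtain ⟨-, -, hsubU⟩ := mem_filter.mp hmem
  exact hxU (hsubU hxfg)

/-- **(MS2) for members distinguished outside the designated sets** (hp-7 gen 76, unconditional).  Let `D₅ ⊆ P \\ Q` and
`D₂ ⊆ Q \\ P` be any designated cross differences, none empty, and suppose the members of `F = P ∪ Q` have pairwise distinct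
traces outside `U = ⋃ (D₅ ∪ D₂)`.  Then `#(F ∪ D₅ ∪ D₂) ≤ #(F \\ F ∪ P \\ D₅ ∪ Q \\ D₂)` — indeed already `≤ #(F \\ F)`. -/
theorem ms2_of_injOn_sdiff (P Q D₅ D₂ : Finset (Finset α)) (hD₅ : D₅ ⊆ P \\ Q) (hD₂ : D₂ ⊆ Q \\ P)
    (h0 : (∅ : Finset α) ∉ D₅ ∪ D₂)
    (hinj : Set.InjOn (fun f => f \ (D₅ ∪ D₂).sup id) ↑(P ∪ Q)) :
    #((P ∪ Q) ∪ D₅ ∪ D₂) ≤ #(((P ∪ Q) \\ (P ∪ Q)) ∪ (P \\ D₅) ∪ (Q \\ D₂)) := by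
  classical
  set F := P ∪ Q with hFdef
  set D := D₅ ∪ D₂ with hDdef
  set U := D.sup id with hUdef
  have h1 : (P ∪ Q) ∪ D₅ ∪ D₂ = F ∪ D := by rw [hDdef, union_assoc]
  rw [h1]
  have hDsub : D ⊆ (F \\ F).filter (fun t => t ≠ ∅ ∧ t ⊆ U) := by
    intro d hd
    refine mem_filter.mpr ⟨?_, ?_, ?_⟩
    · rcases mem_union.mp hd with hd5 | hd2
      · obtain ⟨a, ha, b, hb, rfl⟩ := mem_diffs.mp (hD₅ hd5)
        exact mem_diffs.mpr ⟨a, mem_union_left _ ha, b, mem_union_right _ hb, rfl⟩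
      · obtain ⟨a, ha, b, hb, rfl⟩ := mem_diffs.mp (hD₂ hd2)
        exact mem_diffs.mpr ⟨a, mem_union_right _ ha, b, mem_union_left _ hb, rfl⟩
    · rintro rfl
      exact h0 hd
    · exact le_sup (f := id) hd
  calc #(F ∪ D) ≤ #F + #D := card_union_le F D
    _ ≤ #F + #((F \\ F).filter (fun t => t ≠ ∅ ∧ t ⊆ U)) := by
        have := card_le_card hDsub
        omega
    _ ≤ #(F \\ F) := card_add_card_le_card_diffs_of_injOn_sdiff F U hinj
    _ ≤ #((F \\ F) ∪ (P \\ D₅) ∪ (Q \\ D₂)) :=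
        card_le_card (subset_union_left.trans subset_union_left)

/-- The same from the hypotheses of `GeneratedDonors.MS2` (purity instead of `∅ ∉ D₅ ∪ D₂`): (MS2) holds for every instance whose
members are pairwise distinct outside the union of the designated differences. -/
theorem ms2_of_injOn_sdiff' (P Q D₅ D₂ : Finset (Finset α)) (hD₅ : D₅ ⊆ P \\ Q) (hD₂ : D₂ ⊆ Q \\ P)
    (hpure : ∀ d ∈ D₅ ∪ D₂, d ∉ (P \\ P) ∪ (Q \\ Q))
    (hinj : Set.InjOn (fun f => f \ (D₅ ∪ D₂).sup id) ↑(P ∪ Q)) :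
    #((P ∪ Q) ∪ D₅ ∪ D₂) ≤ #(((P ∪ Q) \\ (P ∪ Q)) ∪ (P \\ D₅) ∪ (Q \\ D₂)) := by
  refine ms2_of_injOn_sdiff P Q D₅ D₂ hD₅ hD₂ ?_ hinj
  intro h0
  rcases mem_union.mp h0 with h5 | h2
  · obtain ⟨p, hp, -, -, -⟩ := mem_diffs.mp (hD₅ h5)
    exact hpure ∅ h0 (mem_union_left _ (mem_diffs.mpr ⟨p, hp, p, hp, (by simp : p \ p = ∅)⟩))
  · obtain ⟨q, hq, -, -, -⟩ := mem_diffs.mp (hD₂ h2)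
    exact hpure ∅ h0 (mem_union_right _ (mem_diffs.mpr ⟨q, hq, q, hq, (by simp : q \ q = ∅)⟩))

/-! ### One-type (MS2) under block order (appended, hp-7 gen 76)

The first order RULE landed via the reserved-terms lemma: designated differences of ONE type (`D₅ ⊆ P \\ Q`, `D₂ = ∅`), the whole
`Q`-block placed BEFORE the `P`-block (each block by decreasing size).  Then every designated `d = p \ q` is a BACKWARD difference
and survives as itself (`τ = id`); the forward differences are `q \ q'`, `p \ p'` (never designated, by purity), and `q \ p` — so the
rule needs (i) no member of `Q` inside a member of `P` (else `q \ p = ∅` would be forward) and (ii) no designated set of the reverse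
form `q \ p`.  This is incomparable with gen 74's `TopsSuffice.card_le_card_diffs_union_diffs_of_subset_diffs` (no `q ⊇ d`): it allows
cross containment `q ⊇ d` as long as `d` is not literally some `q \ p'`.  (Memo `FROM-prim-hp-7-g76-ORDER-CERTIFICATES.md` §0 (D)(iv):
the same rule with containments interleaved works numerically whenever the relation 'q before p unless q ⊊ p' is acyclic.) -/

/-- **One-type (MS2) under block order** (hp-7 gen 76).  Let `P`, `Q` be disjoint, `D₅ ⊆ P \\ Q` pure (no designated set is a
difference inside a block), no member of `Q` contained in a member of `P`, and no designated set of the form `q \ p`.  Then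
`#((P ∪ Q) ∪ D₅) ≤ #((P ∪ Q) \\ (P ∪ Q) ∪ P \\ D₅)` — indeed already `#(P ∪ Q) + #D₅ ≤ #((P ∪ Q) \\ (P ∪ Q))`. -/
theorem card_add_card_le_card_diffs_of_blockOrder (P Q D₅ : Finset (Finset α)) (hPQ : Disjoint P Q)
    (hD₅ : D₅ ⊆ P \\ Q) (hpure : ∀ d ∈ D₅, d ∉ (P \\ P) ∪ (Q \\ Q))
    (hcont : ∀ q ∈ Q, ∀ p ∈ P, ¬ q ⊆ p) (hrev : ∀ d ∈ D₅, d ∉ Q \\ P) :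
    #(P ∪ Q) + #D₅ ≤ #((P ∪ Q) \\ (P ∪ Q)) := by
  classical
  set F := P ∪ Q with hFdef
  rcases F.eq_empty_or_nonempty with hF0 | ⟨f₀, hf₀⟩
  · have hP : P = ∅ := subset_empty.mp (hF0 ▸ (subset_union_left : P ⊆ F))
    have hD0 : D₅ = ∅ := by
      rw [eq_empty_iff_forall_notMem]
      intro d hd
      obtain ⟨p, hp, -, -, -⟩ := mem_diffs.mp (hD₅ hd)
      rw [hP] at hp
      simp at hp
    rw [hF0, hD0]
    simp
  -- the rank: `Q` first (rank `-#q ≤ 0`), then `P` (rank `M + 1 - #p ≥ 1`)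
  set M : ℕ := F.sup card with hM
  have hcardM : ∀ {f : Finset α}, f ∈ F → #f ≤ M := fun hf => le_sup (f := card) hf
  let r : Finset α → ℤ := fun f => (if f ∈ P then (M : ℤ) + 1 else 0) - (#f : ℤ)
  have hQnotP : ∀ {q : Finset α}, q ∈ Q → q ∉ P := fun hq hp => disjoint_left.mp hPQ hp hq
  have h0D : (∅ : Finset α) ∉ D₅ := by
    intro h0
    obtain ⟨p, hp, -, -, -⟩ := mem_diffs.mp (hD₅ h0)
    exact hpure ∅ h0 (mem_union_left _ (mem_diffs.mpr ⟨p, hp, p, hp, (by simp : p \ p = ∅)⟩))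
  -- same-block pairs: larger first, so `f ⊄ g`
  have hblock : ∀ {f g : Finset α}, f ≠ g → #g ≤ #f → f \ g ≠ ∅ := by
    intro f g hne hle h0
    exact hne (eq_of_subset_of_card_le (sdiff_eq_empty_iff_subset.mp h0) hle)
  refine card_add_card_le_card_of_reserved F (F \\ F) D₅ r
    (mem_diffs.mpr ⟨f₀, hf₀, f₀, hf₀, (by simp : f₀ \ f₀ = ∅)⟩) ?_ h0D ?_
  · intro d hd
    obtain ⟨p, hp, q, hq, rfl⟩ := mem_diffs.mp (hD₅ hd)
    exact mem_diffs.mpr ⟨p, mem_union_left _ hp, q, mem_union_right _ hq, rfl⟩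
  · intro f hf g hg hne hr
    refine ⟨mem_diffs.mpr ⟨f, hf, g, hg, rfl⟩, ?_⟩
    rcases mem_union.mp hf with hfP | hfQ <;> rcases mem_union.mp hg with hgP | hgQ
    · -- `P`/`P`
      have hle : #g ≤ #f := by
        have : r f ≤ r g := hr
        simp only [r, if_pos hfP, if_pos hgP] at this
        omega
      exact ⟨hblock hne hle, fun hd => hpure _ hd (mem_union_left _ (mem_diffs.mpr ⟨f, hfP, g, hgP, rfl⟩))⟩
    · -- `P` before `Q`: impossible along `r`
      exfalso
      have : r f ≤ r g := hr
      simp only [r, if_pos hfP, if_neg (hQnotP hgQ)] at this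
      have := hcardM hf
      omega
    · -- `Q`/`P`: `q \ p` is nonempty and never designated
      refine ⟨fun h0 => hcont f hfQ g hgP (sdiff_eq_empty_iff_subset.mp h0), fun hd => hrev _ hd ?_⟩
      exact mem_diffs.mpr ⟨f, hfQ, g, hgP, rfl⟩
    · -- `Q`/`Q`
      have hle : #g ≤ #f := by
        have : r f ≤ r g := hr
        simp only [r, if_neg (hQnotP hfQ), if_neg (hQnotP hgQ)] at this
        omega
      exact ⟨hblock hne hle, fun hd => hpure _ hd (mem_union_right _ (mem_diffs.mpr ⟨f, hfQ, g, hgQ, rfl⟩))⟩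

/-- The (MS2)-shaped corollary: under the hypotheses of `card_add_card_le_card_diffs_of_blockOrder`,
`#((P ∪ Q) ∪ D₅) ≤ #((P ∪ Q) \\ (P ∪ Q) ∪ P \\ D₅)`.  (For designated sets of type 2 only, apply it with the roles of `P` and `Q`
exchanged.) -/
theorem card_le_card_diffs_union_diffs_of_blockOrder (P Q D₅ : Finset (Finset α)) (hPQ : Disjoint P Q)
    (hD₅ : D₅ ⊆ P \\ Q) (hpure : ∀ d ∈ D₅, d ∉ (P \\ P) ∪ (Q \\ Q))
    (hcont : ∀ q ∈ Q, ∀ p ∈ P, ¬ q ⊆ p) (hrev : ∀ d ∈ D₅, d ∉ Q \\ P) :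
    #((P ∪ Q) ∪ D₅) ≤ #(((P ∪ Q) \\ (P ∪ Q)) ∪ (P \\ D₅)) :=
  calc #((P ∪ Q) ∪ D₅) ≤ #(P ∪ Q) + #D₅ := card_union_le _ _
    _ ≤ #((P ∪ Q) \\ (P ∪ Q)) := card_add_card_le_card_diffs_of_blockOrder P Q D₅ hPQ hD₅ hpure hcont hrev
    _ ≤ #(((P ∪ Q) \\ (P ∪ Q)) ∪ (P \\ D₅)) := card_le_card subset_union_left

/-! ### The linear form of the reduction: incidence certificates (appended, hp-7 gen 76)

The triangular order certificates above are one way of proving that the members' restricted down-set indicator vectors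
`χ_f = (E ↦ [E ⊆ f])_{E ∈ T \ Θ}` are linearly independent; any other proof of that independence gives the same counting conclusion
`#F + #Θ ≤ #T`.  The gen-76 census (memo §6 (F)) shows that for the natural reserved sets `Θ = τ(D)`, `τ d ∈ {d} ∪ {m \ d : m in d's block}`,
this LINEAR certificate exists for every one of 242 400 intersecting instances tested (including all 73 'butterflies', where no triangular
certificate with complement columns exists): conjecture (INC-nat).  The two lemmas below are the glue a proof of (INC-nat) needs. -/

/-- **Incidence certificates** (hp-7 gen 76): if `Θ ⊆ T` and the restricted containment vectors
`χ_f : (T \ Θ) → ℚ`, `χ_f E = [E ⊆ f]` (`f ∈ F`) are linearly independent, then `#F + #Θ ≤ #T`. -/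
theorem card_add_card_le_card_of_linearIndependent (F T Θ : Finset (Finset α)) (hΘT : Θ ⊆ T)
    (hli : LinearIndependent ℚ
      (fun (f : ↥F) (E : ↥(T \ Θ)) => if (E : Finset α) ⊆ (f : Finset α) then (1 : ℚ) else 0)) :
    #F + #Θ ≤ #T := by
  classical
  have h1 : Fintype.card ↥F ≤ Module.finrank ℚ (↥(T \ Θ) → ℚ) := hli.fintype_card_le_finrank
  rw [Module.finrank_fintype_fun_eq_card, Fintype.card_coe, Fintype.card_coe,
    card_sdiff_of_subset hΘT] at h1
  have h2 : #Θ ≤ #T := card_le_card hΘT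
  omega

/-- **(MS2) from an incidence certificate** (hp-7 gen 76): for `D₅ ⊆ P \\ Q`, `D₂ ⊆ Q \\ P` and `T = F \\ F ∪ P \\ D₅ ∪ Q \\ D₂`
(`F = P ∪ Q`), a map `τ` injective on `D₅ ∪ D₂` with values in `T` such that the containment vectors of the members restricted to
`T \ τ(D₅ ∪ D₂)` are linearly independent over `ℚ` gives the (MS2) inequality for the instance.  (Conjecture (INC-nat), memo
`FROM-prim-hp-7-g76-ORDER-CERTIFICATES.md` §6 (F): for pairwise intersecting `F` such a `τ` with `τ d ∈ {d} ∪ {m \ d}` always exists.) -/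
theorem ms2_of_incCert (P Q D₅ D₂ : Finset (Finset α)) (τ : Finset α → Finset α)
    (hτT : ∀ d ∈ D₅ ∪ D₂, τ d ∈ ((P ∪ Q) \\ (P ∪ Q)) ∪ (P \\ D₅) ∪ (Q \\ D₂)) (hτinj : Set.InjOn τ ↑(D₅ ∪ D₂))
    (hli : LinearIndependent ℚ
      (fun (f : ↥(P ∪ Q)) (E : ↥((((P ∪ Q) \\ (P ∪ Q)) ∪ (P \\ D₅) ∪ (Q \\ D₂)) \ (D₅ ∪ D₂).image τ)) =>
        if (E : Finset α) ⊆ (f : Finset α) then (1 : ℚ) else 0)) :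
    #((P ∪ Q) ∪ D₅ ∪ D₂) ≤ #(((P ∪ Q) \\ (P ∪ Q)) ∪ (P \\ D₅) ∪ (Q \\ D₂)) := by
  classical
  set F := P ∪ Q with hFdef
  set D := D₅ ∪ D₂ with hDdef
  set T := (F \\ F) ∪ (P \\ D₅) ∪ (Q \\ D₂) with hTdef
  have h1 : (P ∪ Q) ∪ D₅ ∪ D₂ = F ∪ D := by rw [hDdef, union_assoc]
  rw [h1]
  have hΘT : D.image τ ⊆ T := by
    intro t ht
    obtain ⟨d, hd, rfl⟩ := mem_image.mp ht
    exact hτT d hd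
  have hres := card_add_card_le_card_of_linearIndependent F T (D.image τ) hΘT hli
  rw [card_image_of_injOn hτinj] at hres
  exact (card_union_le F D).trans hres

end ReservedTerms

end Summit.CriticalPhenomena.PercolationContinuityZ3.Theorems
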